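import Literature.AlgebraicGeometry.Resolution.DualDerivationsPrimeField
import Mathlib.RingTheory.Ideal.Span
import HarnessLib

/-!
# Generators of Giraud's log-Jacobian content ideal at a point (Giraud 1983, 1.1 (2)–(3), Ω-free)

Route `ResolutionOfSingularities/RadicialJung`, crux `CleanModels` (stmt-ResolutionOfSingularities-15917),
line `via-clean-models` of crux `DescentPerfectToAll` (stmt-ResolutionOfSingularities-0549): brick
K3c-iv(a) of PROGRAMME-clean-dim2 (Giraud's normal form over an ARBITRARY ground field). Helper
file (`--supports`), OURS; nothing here is a statement of Hironaka's manuscript.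

Giraud (Bull. SMF 111 (1983), 1.1 (2)–(3)): in differential coordinates `(x₁, …, x_n)` with
`E = div(x^a)`, the log-Jacobian ideal `J(X, f, E)` is generated by the `x_i ∂f/∂x_i` (`a(i) ≠ 0`)
and the `∂f/∂x_j` (`a(j) = 0`). Ω-free form over an arbitrary field, at a local ring `O` formally
smooth over `𝔽_p` (every regular local ring essentially of finite type over any field of
characteristic `p`), with boundary equations `x : Fin r → 𝔪` independent in `𝔪/𝔪²` and the dual
derivations `∂_j` (`∂_j x_i = δ_ij`, `exists_dual_derivations_int`): every derivation `D` splits as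
`D = Σ_j D(x_j) ∂_j + D₀` with `D₀ x = 0`, and `D` is logarithmic along `x` (`x_j ∣ D x_j`) iff the
coefficients `D(x_j)` are multiples of `x_j`. Hence

* `span_logDerivation_apply_eq` — **`J(f; x) := span{D f : D ∈ Der(O), x_j ∣ D x_j ∀ j}`
  `= span({x_j · ∂_j f : j} ∪ {D₀ f : D₀ ∈ Der(O), D₀ x_j = 0 ∀ j})`** (Giraud's generators, with the
  residual "boundary-transversal" derivations `D₀` playing the rôle of the `∂/∂x_j`, `a(j) = 0`, and
  of the `∂/∂u_λ` of a `p`-basis of the residue field).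

## References
* J. Giraud, *Forme normale d'une fonction sur une surface de caractéristique positive*, Bull. Soc.
  Math. France 111 (1983), 1.1 (2)–(3). [Giraud1983]
* H. Matsumura, *Commutative Ring Theory* (1986), Thm. 30.6 (ii). [Matsumura1987]
-/

noncomputable section

set_option linter.dupNamespace false -- mandated namespace of this single-conjunct summit

open IsLocalRing
open Literature.AlgebraicGeometry.Resolution

namespace Summit.ResolutionOfSingularities.ResolutionOfSingularities.Theorems.RadicialJung.CleanModels

universe u

/-- **Splitting a derivation along dual derivations.** If `∂_j x_i = δ_ij` then
`D₀ := D - Σ_j D(x_j) • ∂_j` kills every `x_i`. [cite: Matsumura1987, Thm. 30.6 (ii)] -/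
theorem derivation_sub_sum_smul_apply_eq_zero {O : Type u} [CommRing O] {r : ℕ} (x : Fin r → O)
    (δ : Fin r → Derivation ℤ O O) (hδ : ∀ i j, δ i (x j) = if i = j then 1 else 0)
    (D : Derivation ℤ O O) (i : Fin r) :
    (D - ∑ j, D (x j) • δ j) (x i) = 0 := by
  classical
  rw [Derivation.sub_apply, derivation_sum_apply]
  simp only [Derivation.smul_apply, smul_eq_mul, hδ, mul_ite, mul_one, mul_zero,
    Finset.sum_ite_eq', Finset.mem_univ, if_true, sub_self]

/-- **Giraud's generators of the log-Jacobian content ideal, Ω-free** (1.1 (2)–(3)): for a local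
ring `O` formally smooth over `𝔽_p`, boundary equations `x : Fin r → 𝔪` with independent images in
`𝔪/𝔪²`, and `f ∈ O`, the ideal generated by the values `D f` of the LOGARITHMIC derivations
(`x_j ∣ D x_j` for all `j`) equals the ideal generated by the `x_j · ∂_j f` (`∂` the dual
derivations) together with the values `D₀ f` of the derivations killing every `x_j`.
[cite: Giraud1983, 1.1 (2)–(3)] [cite: Matsumura1987, Thm. 30.6 (ii)] -/
theorem span_logDerivation_apply_eq (p : ℕ) [Fact p.Prime] {O : Type u} [CommRing O]
    [IsLocalRing O] [Algebra (ZMod p) O] [Algebra.FormallySmooth (ZMod p) O] {r : ℕ}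
    {x : Fin r → O} (hx : ∀ j, x j ∈ maximalIdeal O)
    (hli : LinearIndependent (ResidueField O) fun j => (maximalIdeal O).toCotangent ⟨x j, hx j⟩)
    (f : O) :
    ∃ δ : Fin r → Derivation ℤ O O, (∀ i j, δ i (x j) = if i = j then 1 else 0) ∧
      Ideal.span {v : O | ∃ D : Derivation ℤ O O, (∀ j, x j ∣ D (x j)) ∧ D f = v} =
        Ideal.span ((Set.range fun j => x j * δ j f) ∪
          {v : O | ∃ D : Derivation ℤ O O, (∀ j, D (x j) = 0) ∧ D f = v}) := by
  classical
  obtain ⟨δ, hδ⟩ := exists_dual_derivations_int p x hx hli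
  refine ⟨δ, hδ, le_antisymm ?_ ?_⟩
  · -- a log derivation `D` with `D x_j = a_j x_j`: `D f = Σ a_j (x_j ∂_j f) + D₀ f`
    rw [Ideal.span_le]
    rintro _ ⟨D, hlog, rfl⟩
    choose a ha using hlog
    let D₀ : Derivation ℤ O O := D - ∑ j, D (x j) • δ j
    have hD₀ : ∀ j, D₀ (x j) = 0 := derivation_sub_sum_smul_apply_eq_zero x δ hδ D
    have hsplit : D f = ∑ j, a j * (x j * δ j f) + D₀ f := by
      have : D₀ f = D f - ∑ j, D (x j) * δ j f := by
        change (D - ∑ j, D (x j) • δ j) f = _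
        rw [Derivation.sub_apply, derivation_sum_apply]
        simp only [Derivation.smul_apply, smul_eq_mul]
      rw [this]
      have hsum : ∑ j, D (x j) * δ j f = ∑ j, a j * (x j * δ j f) :=
        Finset.sum_congr rfl fun j _ => by rw [ha j]; ring
      rw [hsum]
      ring
    rw [SetLike.mem_coe, hsplit]
    refine Ideal.add_mem _ (Ideal.sum_mem _ fun j _ => Ideal.mul_mem_left _ _
      (Ideal.subset_span (Or.inl ⟨j, rfl⟩))) (Ideal.subset_span (Or.inr ⟨D₀, hD₀, rfl⟩))
  · rw [Ideal.span_le]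
    rintro v (⟨j, rfl⟩ | ⟨D, hD0, rfl⟩)
    · -- `x_j ∂_j` is logarithmic: `(x_j ∂_j)(x_i) = x_j δ_ij`
      refine Ideal.subset_span ⟨x j • δ j, fun i => ?_, by simp [smul_eq_mul]⟩
      rw [Derivation.smul_apply, smul_eq_mul, hδ]
      by_cases h : j = i
      · subst h; simp
      · simp [h]
    · exact Ideal.subset_span ⟨D, fun j => ⟨0, by rw [hD0 j, mul_zero]⟩, rfl⟩

end Summit.ResolutionOfSingularities.ResolutionOfSingularities.Theorems.RadicialJung.CleanModels

end
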